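import Literature.NumberTheory.Sieve.SingularSeries
import Mathlib.MeasureTheory.Integral.IntervalIntegral.Basic
import Mathlib.Analysis.SpecialFunctions.Pow.Real
import Mathlib.Analysis.SpecialFunctions.Complex.Circle
import HarnessLib

/-!
# Green–Tao (2006): the enveloping sieve and its `L^p` extension (restriction) estimate

B. Green, T. Tao, *Restriction theory of the Selberg sieve, with applications*, J. Théor. Nombres
Bordeaux **18** (2006) 147–182 [GreenTao2006Restriction] (arXiv:math/0405581, §§1, 3, 4 read).

Setting (§1): `F(n) = ∏_{i=1}^k (aᵢ n + bᵢ)` a product of `k` integer linear forms with non-zero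
discriminant, `γ(q) := q⁻¹ #{n ∈ ℤ/qℤ : (q, F(n)) = 1}`, the non-degeneracy condition
`γ(q) > 0` for all `q ≥ 1`, and the singular series `𝔖_F := ∏_p γ(p) (1 − 1/p)^{−k}`;
`X_{R!} := {n ∈ ℤ : (d, F(n)) = 1 for all 1 ≤ d ≤ R}` (§3).

* **Proposition 3.1 (the enveloping sieve).** *Let `F` be as above with `|aᵢ|, |bᵢ| ≤ N` and let
  `R ≤ N` be a large integer. Then there is a non-negative `β = β_R : ℤ → ℝ⁺` with
  (i) `β(n) ≫_k 𝔖_F⁻¹ log^k R · 1_{X_{R!}}(n)` for all integers `n`; (ii) `β(n) ≪_{k,ε} N^ε` for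
  `0 < n ≤ N`; (iii) `β(n) = ∑_{q ≤ R²} ∑_{a ∈ ℤ_q^*} w(a/q) e_q(−an)` with
  `|w(a/q)| ≪_{k,ε} q^{ε−1}`, `w(0) = w(1) = 1`; (iv) `w(a/q) = 0` unless `q` is square-free, and
  `w(a/q) = 0` if `γ(q) = 1`, `q > 1`.*
* **Proposition 4.2 (`L^p` extension estimate for `β`).** *Let `R, N` be large with
  `1 ≪ R ≪ N^{1/10}`, let `k, F, β_R` be as in Prop. 3.1, `(a_n)_{n ≤ N}` complex and `p > 2`
  fixed. Then `‖E_{1≤n≤N} a_n β_R(n) e(nθ)‖_{L^p(𝕋)} ≪_{p,k} N^{−1/p} (E_{1≤n≤N} |a_n|² β_R(n))^{1/2}`*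
  (second display; the first display is the same on `ℤ_N`).
* Theorem 1.1 (`‖∑_{n ≤ N, n ∈ X(F)} e(nθ)‖_p ≪_{p,k} 𝔖_F N^{1−1/p} (log N)^{−k}`) is the corollary
  for the indicator of `X(F)`; it is NOT vendored here.

## What is vendored, and how

ONE named fact, `GreenTao2006_envelopingSieve_extension`: for the sub-case of MONIC forms
`F(n) = ∏_{h ∈ H} (n + h)` (`aᵢ = 1`, `bᵢ = h` pairwise distinct — a `Finset ℤ`; this is the case
of prime `k`-tuples `n + h₁, …, n + h_k`, e.g. twin primes `H = {0, 2}`), the EXISTENCE of a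
non-negative `β : ℤ → ℝ` satisfying property (i) of Prop. 3.1 together with the `L^p(𝕋)`
extension estimate of Prop. 4.2. This is a sub-statement of "Prop. 3.1 ∧ Prop. 4.2" as printed
(the constructed `β_R` has all the properties; we keep (i) and the second display of 4.2 and drop
(ii)–(iv) and the `ℤ_N` display), specialised to `aᵢ = 1`:

* for `F(n) = ∏_{h ∈ H}(n + h)`: `(q, F(n)) = 1` iff `q ∤ n + h` for all prime `q' ∣ q`, `h ∈ H`;
  `γ(p) = 1 − ν_H(p)/p` with `ν_H(p)` the number of residues mod `p` met by `H` (equivalently by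
  `−H`), so `𝔖_F` is EXACTLY the tree's Hardy–Littlewood singular series `singularSeries H`
  (`SingularSeries.lean`, factors `(1 − ν_H(p)/p)(1 − 1/p)^{−k}`), the non-degeneracy condition is
  `IsAdmissibleTuple H` (by CRT it suffices to test primes, loc. cit. Remark after (1.3)), and
  the discriminant `∏_{i<j}(hⱼ − hᵢ)` is automatically non-zero;
* `n ∈ X_{R!}` iff no prime `q ≤ R` divides any `n + h`;
* "`R, N` large, `1 ≪ R ≪ N^{1/10}`" is rendered `∃ R₀ N₀, ∀ N ≥ N₀, ∀ R, R₀ ≤ R ∧ R^{10} ≤ N`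
  (implicit constant `1` in `R ≪ N^{1/10}`: a sub-range), `≫_k` / `≪_{p,k}` as constants
  `c, C > 0` chosen after `k, p`; `E_{1 ≤ n ≤ N} = N⁻¹ ∑_{n=1}^{N}`, `e(nθ) = exp(2πi nθ)`,
  `‖g‖_{L^p(𝕋)} = (∫₀¹ |g(θ)|^p dθ)^{1/p}`; `k ≥ 1`.

## References

* [GreenTao2006Restriction] B. Green, T. Tao, JTNB 18 (2006) 147–182; arXiv:math/0405581:
  §1 (γ, 𝔖_F, non-degeneracy), Prop. 3.1, Prop. 4.2, Thm. 1.1.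
* G. H. Hardy, J. E. Littlewood (1923) — singular series; tree file `SingularSeries.lean`.
-/

noncomputable section

open MeasureTheory Real Complex Finset

namespace Literature.NumberTheory.Sieve

/-- **Green–Tao 2006, Prop. 3.1 (i) with Prop. 4.2 (enveloping sieve + `L^p` extension estimate),
monic-tuple case; named fact.** For every `k ≥ 1` and `p > 2` there are `c, C > 0` and `R₀, N₀`
such that for every tuple `H` of `k` distinct integers which is admissible (`γ(q) > 0` for all
`q`) with `|h| ≤ N` for `h ∈ H`, and all `N ≥ N₀`, `R ≥ R₀` with `R^{10} ≤ N`, there is a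
non-negative `β = β_R : ℤ → ℝ` (the enveloping sieve for `F(n) = ∏_{h ∈ H}(n + h)`) with
(i) `β(n) ≥ c (log R)^k / 𝔖(H)` whenever no prime `q ≤ R` divides any `n + h` (`n ∈ X_{R!}`), and
(4.2) for every complex sequence `(u_n)`:
`(∫₀¹ |N⁻¹ ∑_{n=1}^N u_n β(n) e(nθ)|^p dθ)^{1/p} ≤ C N^{−1/p} (N⁻¹ ∑_{n=1}^N |u_n|² β(n))^{1/2}`.
Sub-statement of the printed Prop. 3.1 ∧ Prop. 4.2 (module docstring): properties (ii)–(iv) and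
the `ℤ_N`-display are dropped, forms are monic. [cite: GreenTao2006Restriction, Prop. 3.1 (i) and Prop. 4.2] -/
def GreenTao2006_envelopingSieve_extension : Prop :=
  ∀ (k : ℕ) (p : ℝ), 1 ≤ k → 2 < p → ∃ (c C : ℝ) (R₀ N₀ : ℕ), 0 < c ∧ 0 < C ∧
    ∀ (H : Finset ℤ) (N R : ℕ), H.card = k → IsAdmissibleTuple H → (∀ h ∈ H, |h| ≤ (N : ℤ)) →
      N₀ ≤ N → R₀ ≤ R → (R : ℝ) ^ (10 : ℕ) ≤ N →
      ∃ β : ℤ → ℝ, (∀ n, 0 ≤ β n) ∧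
        (∀ n : ℤ, (∀ q : ℕ, q.Prime → q ≤ R → ∀ h ∈ H, ¬ ((q : ℤ) ∣ n + h)) →
          c * Real.log R ^ k / singularSeries H ≤ β n) ∧
        ∀ u : ℕ → ℂ,
          (∫ θ in (0 : ℝ)..1,
              ‖(N : ℂ)⁻¹ * ∑ n ∈ Finset.Icc 1 N,
                  u n * (β n : ℂ) * Complex.exp (2 * Real.pi * Complex.I * (n : ℂ) * (θ : ℂ))‖ ^ p) ^
              (1 / p) ≤
            C * (N : ℝ) ^ (-(1 / p)) *
              ((N : ℝ)⁻¹ * ∑ n ∈ Finset.Icc 1 N, ‖u n‖ ^ 2 * β n) ^ (1 / 2 : ℝ)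

/-- **Corollary (twin-prime instance, `H = {0, 2}`, `k = 2`)**: the form used by route
`Parity/VinogradovForTwins` (`F(n) = n(n+2)`): under the named fact, for every `p > 2` there are
`c, C > 0`, `R₀, N₀` such that for `N ≥ N₀`, `R ≥ R₀`, `R^{10} ≤ N` (and `2 ≤ N`) an enveloping
sieve `β ≥ 0` for the twin-prime polynomial exists with `β(n) ≥ c (log R)² / 𝔖({0,2})` whenever
`n` and `n + 2` have no prime factor `≤ R`, and with the `L^p` extension estimate.
[cite: GreenTao2006Restriction, Prop. 3.1 (i) and Prop. 4.2] -/
theorem GreenTao2006_envelopingSieve_extension.twin (hGT : GreenTao2006_envelopingSieve_extension)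
    (p : ℝ) (hp : 2 < p) :
    ∃ (c C : ℝ) (R₀ N₀ : ℕ), 0 < c ∧ 0 < C ∧ ∀ (N R : ℕ), 2 ≤ N → N₀ ≤ N → R₀ ≤ R →
      (R : ℝ) ^ (10 : ℕ) ≤ N →
      ∃ β : ℤ → ℝ, (∀ n, 0 ≤ β n) ∧
        (∀ n : ℤ, (∀ q : ℕ, q.Prime → q ≤ R → ¬ ((q : ℤ) ∣ n) ∧ ¬ ((q : ℤ) ∣ n + 2)) →
          c * Real.log R ^ 2 / singularSeries ({0, 2} : Finset ℤ) ≤ β n) ∧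
        ∀ u : ℕ → ℂ,
          (∫ θ in (0 : ℝ)..1,
              ‖(N : ℂ)⁻¹ * ∑ n ∈ Finset.Icc 1 N,
                  u n * (β n : ℂ) * Complex.exp (2 * Real.pi * Complex.I * (n : ℂ) * (θ : ℂ))‖ ^ p) ^
              (1 / p) ≤
            C * (N : ℝ) ^ (-(1 / p)) *
              ((N : ℝ)⁻¹ * ∑ n ∈ Finset.Icc 1 N, ‖u n‖ ^ 2 * β n) ^ (1 / 2 : ℝ) := by
  obtain ⟨c, C, R₀, N₀, hc, hC, h⟩ := hGT 2 p one_le_two hp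
  refine ⟨c, C, R₀, N₀, hc, hC, fun N R hN2 hN hR hRN => ?_⟩
  have hcard : ({0, 2} : Finset ℤ).card = 2 := by decide
  have habs : ∀ h ∈ ({0, 2} : Finset ℤ), |h| ≤ (N : ℤ) := by
    intro h hh
    simp only [Finset.mem_insert, Finset.mem_singleton] at hh
    rcases hh with rfl | rfl
    · simp
    · simpa using hN2
  obtain ⟨β, hβ0, hβi, hβp⟩ := h {0, 2} N R hcard isAdmissibleTuple_pair habs hN hR hRN
  refine ⟨β, hβ0, fun n hn => hβi n fun q hq hqR h hh => ?_, hβp⟩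
  simp only [Finset.mem_insert, Finset.mem_singleton] at hh
  rcases hh with rfl | rfl
  · simpa using (hn q hq hqR).1
  · exact (hn q hq hqR).2

end Literature.NumberTheory.Sieve

end
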